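import Literature.NumberTheory.EllipticCurves.Kato2004.IwasawaH1CharacterFunctionalProofs
import HarnessLib

/-!
# Kato 2004, reading step T22 (b) of the descent sockets — the rank-one rigidity theorem with a FINITE SET of
# admissible ratios: two `Λ`-adic classes whose character values are proportional by ratios drawn from a finite set
# `P ⊂ ℂ_pˣ` generate the same line at every height-one prime `𝔮 ∌ p` (THEOREMS ONLY)

Topic `NumberTheory/EllipticCurves`, sub-directory `Kato2004` (namespace = path). Cell `bsd-2adic`
(run/shared/lean/pub/bsd-2adic/), seat `bsd-2adic-addL2x` GEN 21 (crux stmt-BirchSwinnertonDyer-19098 `AdditiveRankZeroAtTwo`,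
child C4″ stmt-BirchSwinnertonDyer-22618; repair-census entry R-B84 (1)). Sequel of `ZetaLineRankOneRigidityProofs.lean` (GEN 19,
p740449: ONE fixed ratio `α/β`) and `IwasawaH1CharacterFunctionalProofs.lean` (p741570: finite-level eigenfunctionals).

WHY A FINITE SET OF RATIOS. In the odd-branch reading of T22 (b) the values of the transported class `z̃` and of Kato's class
`z` under the SAME finite-level eigenfunctional are related by ONE complex constant (a period ratio), which is recognised as an
element `ρ₀` of a cyclotomic field `ℚ(ζ_{M₀})`; its image in `ℂ_p` under the `p`-adic embedding used at the layer of `χ` is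
`e(ρ₀)` for SOME field embedding `e : ℚ(ζ_{M₀}) → ℂ_p` — one of finitely many. So the `p`-adic ratio is not fixed but lies in the
finite set `P = {e(ρ₀)}`. The rigidity argument survives: if `a • z̃ = b • z` (rank one) and `ρ_χ·a(χ) = b(χ)` with `ρ_χ ∈ P`
off a finite set of characters, then the bounded series `D = ∏_{ρ ∈ P} (ρ·a − b) ∈ ℂ_p⟦T⟧` vanishes at all those character points,
hence `D = 0` (`eq_zero_of_bounded_of_forall_character_hasSum_zero_off_finset`), hence ONE factor vanishes (`ℂ_p⟦T⟧` is a
domain): `ρ·a = b` for a single `ρ ∈ P`, and the GEN 19 conclusion follows (`C c₁·a = C c₂·b` with non-zero constants, which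
are units at every `𝔮 ∌ p`).

* `IwasawaAlgebra.exists_C_mul_eq_C_mul_of_values_proportional_finset` — the analytic core;
* `Kato2004.lengthAt_quotient_span_eq_of_characterValues_proportional_finset` — the module-theoretic skeleton (torsion-free
  rank `≤ 1`, `z ≠ 0`, character functionals non-zero on `z` with `v(z̃) = ρ_χ·v(z)`, `ρ_χ ∈ P ∌ 0`);
* `Kato2004.IwasawaH1Data.lengthAt_quotient_span_eq_of_layerFunctionals_finset` — the consumer shape with FINITE-LEVEL
  eigenfunctionals on a pin `I : IwasawaH1Data W p κ γ` modulo `Kato2004.thm12_4` (Thm. 12.4 (2)).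
Theorems only; no definition, no named fact; `W, p, κ, γ` arbitrary; nothing about BSD is claimed.

References: [Kato2004Asterisque] Thm. 12.4 (2), Thm. 12.5 (1)(2) (pp. 221–222), 13.5 (2) (p. 227), §13.8 (p. 228);
[MazurTateTeitelbaum1986Invent] §I.12–I.14 (uniqueness of bounded interpolants); [Washington1997] §7.1, §13.2.
-/

noncomputable section

open scoped Classical BigOperators
open Polynomial Field
open Literature.NumberTheory.GaloisRepresentations
open Literature.NumberTheory.EllipticCurves.Kato2004.EulerSystemValues

namespace Literature.NumberTheory.EllipticCurves

/-! ## §1 `p`-adic analysis: products of bounded series; proportionality by a ratio from a finite set -/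

section Analysis

variable {p : ℕ} [Fact p.Prime]

/-- Coefficient bounds are non-negative (the bound dominates `‖a_0‖ ≥ 0`). [folklore] -/
private theorem bound_nonneg {F : PowerSeries ℂ_[p]} {C : ℝ} (hF : ∀ i, ‖PowerSeries.coeff i F‖ ≤ C) : 0 ≤ C :=
  (norm_nonneg _).trans (hF 0)

/-- **Products of coefficient-bounded series over `ℂ_p` are coefficient-bounded** (ultrametric inequality on the Cauchy
product `∑_{i+j=n} a_i b_j`). [folklore] -/
private theorem bdd_mul {F G : PowerSeries ℂ_[p]} {C C' : ℝ} (hF : ∀ i, ‖PowerSeries.coeff i F‖ ≤ C)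
    (hG : ∀ i, ‖PowerSeries.coeff i G‖ ≤ C') : ∀ i, ‖PowerSeries.coeff i (F * G)‖ ≤ C * C' := by
  intro i
  rw [PowerSeries.coeff_mul]
  refine IsUltrametricDist.norm_sum_le_of_forall_le_of_nonneg (mul_nonneg (bound_nonneg hF) (bound_nonneg hG))
    fun kl _ ↦ ?_
  rw [norm_mul]
  exact mul_le_mul (hF _) (hG _) (norm_nonneg _) (bound_nonneg hF)

/-- Products over a finite set of coefficient-bounded series are coefficient-bounded, and evaluation at a point of the open
unit disc is multiplicative over the product (`tsum_map_coeff_mul_mul_pow`, by induction on the finite set). [folklore] -/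
private theorem bdd_and_tsum_finsetProd {ι : Type*} (P : Finset ι) (F : ι → PowerSeries ℂ_[p])
    (hF : ∀ ρ ∈ P, ∃ C : ℝ, ∀ i, ‖PowerSeries.coeff i (F ρ)‖ ≤ C) {t : ℂ_[p]} (ht : ‖t‖ < 1) :
    (∃ C : ℝ, ∀ i, ‖PowerSeries.coeff i (∏ ρ ∈ P, F ρ)‖ ≤ C) ∧
      ∑' k, PowerSeries.coeff k (∏ ρ ∈ P, F ρ) * t ^ k = ∏ ρ ∈ P, ∑' k, PowerSeries.coeff k (F ρ) * t ^ k := by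
  classical
  induction P using Finset.induction_on with
  | empty =>
    refine ⟨⟨1, fun i ↦ ?_⟩, ?_⟩
    · rw [Finset.prod_empty, PowerSeries.coeff_one]; split_ifs <;> simp
    · rw [Finset.prod_empty, Finset.prod_empty]
      have h := hasSum_map_coeff_coe_mul_pow (RingHom.id ℂ_[p]) (1 : Polynomial ℂ_[p]) t
      rw [Polynomial.eval₂_one, Polynomial.coe_one] at h
      simpa only [RingHom.id_apply] using h.tsum_eq
  | insert ρ P hρP ih =>
    obtain ⟨⟨C, hC⟩, hval⟩ := ih (fun σ hσ ↦ hF σ (Finset.mem_insert_of_mem hσ))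
    obtain ⟨C₀, hC₀⟩ := hF ρ (Finset.mem_insert_self ρ P)
    refine ⟨⟨C₀ * C, fun i ↦ ?_⟩, ?_⟩
    · rw [Finset.prod_insert hρP]; exact bdd_mul hC₀ hC i
    · rw [Finset.prod_insert hρP, Finset.prod_insert hρP, ← hval]
      have hmul := tsum_map_coeff_mul_mul_pow (RingHom.id ℂ_[p]) (A := F ρ) (B := ∏ σ ∈ P, F σ)
        (fun k ↦ hC₀ k) (fun k ↦ hC k) ht
      simpa only [RingHom.id_apply] using hmul

/-- The embedding `ℤ_p ↪ ℂ_p` is injective. [folklore] -/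
private theorem injective_algebraMap_padicInt_padicComplex' :
    Function.Injective ((algebraMap ℚ_[p] ℂ_[p]).comp (algebraMap ℤ_[p] ℚ_[p])) :=
  (algebraMap ℚ_[p] ℂ_[p]).injective.comp (IsFractionRing.injective ℤ_[p] ℚ_[p])

/-- **Two elements of `Λ = ℤ_p⟦T⟧` whose character values are proportional by ratios from a FINITE set are proportional by
non-zero CONSTANTS.** Let `a, b ∈ Λ`, `a ≠ 0`, `P ⊂ ℂ_p` finite with `0 ∉ P`, and suppose that for every primitive character `χ`
of `Γ` of `p`-power order with `χ(γ) − 1` outside a finite set `S` there is `ρ ∈ P` with `ρ · a(χ(γ) − 1) = b(χ(γ) − 1)`. Then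
`C c₁ · a = C c₂ · b` for some `c₁, c₂ ∈ ℤ_p ∖ 0`: the bounded series `D = ∏_{ρ ∈ P} (ρ·a − b) ∈ ℂ_p⟦T⟧` vanishes at all those
character points, hence `D = 0` (`eq_zero_of_bounded_of_forall_character_hasSum_zero_off_finset`), hence `ρ·a = b` for ONE
`ρ ∈ P` (a domain), i.e. `ρ a_i = b_i` coefficientwise; with `a_{i₀} ≠ 0`, `b_{i₀}·a = a_{i₀}·b`.
[cite: MazurTateTeitelbaum1986Invent, §I.12–I.14] [cite: Washington1997, §7.1] -/
theorem IwasawaAlgebra.exists_C_mul_eq_C_mul_of_values_proportional_finset {a b : IwasawaAlgebra p}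
    (ha : a ≠ 0) (P : Finset ℂ_[p]) (hP : (0 : ℂ_[p]) ∉ P) (S : Finset ℂ_[p])
    (h : ∀ m : ℕ, 0 < m → ∀ χ : DirichletCharacter ℂ_[p] (p ^ m), χ.IsPrimitive → χ.Even →
      (∃ j : ℕ, orderOf χ = p ^ j) → (χ (cyclotomicGenerator p : ZMod (p ^ m)) - 1) ∉ S →
        ∃ ρ ∈ P, ρ * ∑' i, ((algebraMap ℚ_[p] ℂ_[p]).comp (algebraMap ℤ_[p] ℚ_[p])) (PowerSeries.coeff i a) *
            (χ (cyclotomicGenerator p : ZMod (p ^ m)) - 1) ^ i =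
          ∑' i, ((algebraMap ℚ_[p] ℂ_[p]).comp (algebraMap ℤ_[p] ℚ_[p])) (PowerSeries.coeff i b) *
            (χ (cyclotomicGenerator p : ZMod (p ^ m)) - 1) ^ i) :
    ∃ c₁ c₂ : ℤ_[p], c₁ ≠ 0 ∧ c₂ ≠ 0 ∧ PowerSeries.C c₁ * a = PowerSeries.C c₂ * b := by
  set ι : ℤ_[p] →+* ℂ_[p] := (algebraMap ℚ_[p] ℂ_[p]).comp (algebraMap ℤ_[p] ℚ_[p]) with hι
  have hιinj : Function.Injective ι := injective_algebraMap_padicInt_padicComplex'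
  have hbd : ∀ (A : IwasawaAlgebra p) (k : ℕ), ‖ι (PowerSeries.coeff k A)‖ ≤ 1 :=
    norm_algebraMap_coeff_le_one
  -- the factors `F ρ = ρ·a − b` over `ℂ_p`
  set F : ℂ_[p] → PowerSeries ℂ_[p] := fun ρ ↦
    PowerSeries.C ρ * PowerSeries.map ι a - PowerSeries.map ι b with hFdef
  have hFcoeff : ∀ ρ i, PowerSeries.coeff i (F ρ) = ρ * ι (PowerSeries.coeff i a) - ι (PowerSeries.coeff i b) := by
    intro ρ i
    rw [hFdef]
    simp only [map_sub, PowerSeries.coeff_C_mul, PowerSeries.coeff_map]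
  have hFb : ∀ ρ, ∀ i, ‖PowerSeries.coeff i (F ρ)‖ ≤ ‖ρ‖ + 1 := by
    intro ρ i
    rw [hFcoeff]
    refine (norm_sub_le _ _).trans (add_le_add ?_ (hbd b i))
    rw [norm_mul]; exact mul_le_of_le_one_right (norm_nonneg _) (hbd a i)
  -- the value of `F ρ` at a point `t` of the open disc
  have hFval : ∀ ρ {t : ℂ_[p]}, ‖t‖ < 1 →
      ∑' k, PowerSeries.coeff k (F ρ) * t ^ k =
        ρ * (∑' i, ι (PowerSeries.coeff i a) * t ^ i) - ∑' i, ι (PowerSeries.coeff i b) * t ^ i := by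
    intro ρ t htn
    have hsa := (summable_map_coeff_mul_pow ι (hbd a) htn).hasSum
    have hsb := (summable_map_coeff_mul_pow ι (hbd b) htn).hasSum
    have hlin := (hsa.mul_left ρ).sub hsb
    refine (hlin.congr_fun fun i ↦ ?_).tsum_eq
    rw [hFcoeff]; ring
  -- `D = ∏_{ρ ∈ P} F ρ` vanishes off `S`
  set D : PowerSeries ℂ_[p] := ∏ ρ ∈ P, F ρ with hDdef
  obtain ⟨⟨C, hC⟩, -⟩ := bdd_and_tsum_finsetProd P F (fun ρ _ ↦ ⟨‖ρ‖ + 1, hFb ρ⟩)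
    (t := 0) (by rw [norm_zero]; exact one_pos)
  have hD0 : D = 0 := by
    refine eq_zero_of_bounded_of_forall_character_hasSum_zero_off_finset hC S
      fun m hm χ hχp hχe hχo htS ↦ ?_
    set t : ℂ_[p] := χ (cyclotomicGenerator p : ZMod (p ^ m)) - 1 with ht
    have htn : ‖t‖ < 1 := norm_apply_cyclotomicGenerator_sub_one_lt χ hχo
    obtain ⟨-, hval⟩ := bdd_and_tsum_finsetProd P F (fun ρ _ ↦ ⟨‖ρ‖ + 1, hFb ρ⟩) htn
    have hsum : Summable fun k ↦ PowerSeries.coeff k D * t ^ k := by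
      have hC' : ∀ i, ‖(RingHom.id ℂ_[p]) (PowerSeries.coeff i D)‖ ≤ C := fun i ↦ hC i
      exact summable_map_coeff_mul_pow (RingHom.id ℂ_[p]) hC' htn
    suffices hzero : ∑' k, PowerSeries.coeff k D * t ^ k = 0 by rw [← hzero]; exact hsum.hasSum
    obtain ⟨ρ, hρP, hρ⟩ := h m hm χ hχp hχe hχo htS
    rw [hDdef, hval]
    exact Finset.prod_eq_zero hρP (by rw [hFval ρ htn, hρ, sub_self])
  -- one factor vanishes
  obtain ⟨ρ, hρP, hρ0⟩ := Finset.prod_eq_zero_iff.mp hD0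
  have hρne : ρ ≠ 0 := fun h0 ↦ hP (h0 ▸ hρP)
  -- coefficientwise `ρ a_i = b_i`
  have hcoef : ∀ i, ρ * ι (PowerSeries.coeff i a) = ι (PowerSeries.coeff i b) := by
    intro i
    have := hFcoeff ρ i
    rw [hρ0, map_zero] at this
    exact (sub_eq_zero.mp this.symm)
  -- an index with `a_{i₀} ≠ 0`, hence `b_{i₀} ≠ 0`
  obtain ⟨i₀, hi₀⟩ : ∃ i₀, PowerSeries.coeff i₀ a ≠ 0 := by
    by_contra hall
    push Not at hall
    exact ha (PowerSeries.ext fun i ↦ by rw [hall i, map_zero])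
  have hb₀ : PowerSeries.coeff i₀ b ≠ 0 := by
    intro hb0
    have := hcoef i₀
    rw [hb0, map_zero] at this
    rcases mul_eq_zero.mp this with h1 | h1
    · exact hρne h1
    · exact hi₀ (hιinj (by rw [h1, map_zero]))
  refine ⟨PowerSeries.coeff i₀ b, PowerSeries.coeff i₀ a, hb₀, hi₀, PowerSeries.ext fun i ↦ ?_⟩
  rw [PowerSeries.coeff_C_mul, PowerSeries.coeff_C_mul]
  apply hιinj
  rw [map_mul, map_mul]
  -- `b_{i₀} a_i = a_{i₀} b_i` from `ρ a_i = b_i`, `ρ a_{i₀} = b_{i₀}`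
  rw [← hcoef i, ← hcoef i₀]
  ring

end Analysis

/-! ## §2 The skeleton of T22 (b) with a finite set of ratios -/

namespace Kato2004

variable {p : ℕ} [Fact p.Prime]

/-- **T22 (b) as a theorem, finite-ratio form (Kato 2004, Thm. 12.4 (2) + 12.5 (1)(2) + 13.5 (2), module-theoretic
skeleton).** Let `H` be a torsion-free `Λ`-module of rank `≤ 1`, `z ∈ H` non-zero, `z̃ ∈ H`, and `P ⊂ ℂ_p` a finite set with
`0 ∉ P`. Suppose that for every primitive character `χ` of `Γ` of `p`-power order with `χ(γ) − 1` outside a finite set `S` there is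
an additive functional `v_χ : H → ℂ_p`, `Λ`-SEMILINEAR through `χ`, with `v_χ(z) ≠ 0` and `v_χ(z̃) = ρ·v_χ(z)` for SOME `ρ ∈ P`.
Then `ℓ_𝔮(H/Λz̃) = ℓ_𝔮(H/Λz)` at every prime `𝔮 ∌ p` of `Λ`: rank one gives `a • z̃ = b • z` with `a ≠ 0`; applying `v_χ`,
`ρ_χ·a(χ) = b(χ)`; `IwasawaAlgebra.exists_C_mul_eq_C_mul_of_values_proportional_finset` gives `C c₁·a = C c₂·b` with non-zero
constants (so `b ≠ 0`), torsion-freeness gives `C c₂ • z̃ = C c₁ • z`, and constants are units at `𝔮 ∌ p`. (`z̃ ≠ 0` is a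
consequence, not a hypothesis.) [cite: Kato2004Asterisque, Thm. 12.4 (2) (p. 221), Thm. 12.5 (1)(2) (pp. 221–222), 13.5 (2) (p. 227)]
[cite: MazurTateTeitelbaum1986Invent, §I.12–I.14] [cite: Washington1997, §13.2] -/
theorem lengthAt_quotient_span_eq_of_characterValues_proportional_finset {H : Type*} [AddCommGroup H]
    [Module (IwasawaAlgebra p) H] [Module.IsTorsionFree (IwasawaAlgebra p) H]
    (hrk : Module.rank (IwasawaAlgebra p) H ≤ 1) {z z' : H} (hz : z ≠ 0)
    (P : Finset ℂ_[p]) (hP : (0 : ℂ_[p]) ∉ P) (S : Finset ℂ_[p])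
    (hv : ∀ m : ℕ, 0 < m → ∀ χ : DirichletCharacter ℂ_[p] (p ^ m), χ.IsPrimitive → χ.Even →
      (∃ j : ℕ, orderOf χ = p ^ j) → (χ (cyclotomicGenerator p : ZMod (p ^ m)) - 1) ∉ S →
      ∃ v : H →+ ℂ_[p],
        (∀ (a : IwasawaAlgebra p) (x : H), v (a • x) =
          (∑' i, ((algebraMap ℚ_[p] ℂ_[p]).comp (algebraMap ℤ_[p] ℚ_[p])) (PowerSeries.coeff i a) *
            (χ (cyclotomicGenerator p : ZMod (p ^ m)) - 1) ^ i) * v x) ∧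
        v z ≠ 0 ∧ ∃ ρ ∈ P, v z' = ρ * v z)
    (𝔮 : PrimeSpectrum (IwasawaAlgebra p)) (hp𝔮 : PowerSeries.C (p : ℤ_[p]) ∉ 𝔮.asIdeal) :
    Module.lengthAt (IwasawaAlgebra p) (H ⧸ Submodule.span (IwasawaAlgebra p) {z'}) 𝔮 =
      Module.lengthAt (IwasawaAlgebra p) (H ⧸ Submodule.span (IwasawaAlgebra p) {z}) 𝔮 := by
  -- rank one: `a • z' = b • z`, `a ≠ 0`
  obtain ⟨a, b, ha, hab⟩ := Module.exists_smul_eq_smul_of_rank_le_one hrk hz z'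
  -- the character values: `ρ_χ a(χ) = b(χ)` off `S`
  have hval : ∀ m : ℕ, 0 < m → ∀ χ : DirichletCharacter ℂ_[p] (p ^ m), χ.IsPrimitive → χ.Even →
      (∃ j : ℕ, orderOf χ = p ^ j) → (χ (cyclotomicGenerator p : ZMod (p ^ m)) - 1) ∉ S →
        ∃ ρ ∈ P, ρ * ∑' i, ((algebraMap ℚ_[p] ℂ_[p]).comp (algebraMap ℤ_[p] ℚ_[p])) (PowerSeries.coeff i a) *
            (χ (cyclotomicGenerator p : ZMod (p ^ m)) - 1) ^ i =
          ∑' i, ((algebraMap ℚ_[p] ℂ_[p]).comp (algebraMap ℤ_[p] ℚ_[p])) (PowerSeries.coeff i b) *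
            (χ (cyclotomicGenerator p : ZMod (p ^ m)) - 1) ^ i := by
    intro m hm χ hχp hχe hχo htS
    obtain ⟨v, hvlin, hvz, ρ, hρP, hprop⟩ := hv m hm χ hχp hχe hχo htS
    refine ⟨ρ, hρP, ?_⟩
    set A := ∑' i, ((algebraMap ℚ_[p] ℂ_[p]).comp (algebraMap ℤ_[p] ℚ_[p])) (PowerSeries.coeff i a) *
      (χ (cyclotomicGenerator p : ZMod (p ^ m)) - 1) ^ i with hA
    set B := ∑' i, ((algebraMap ℚ_[p] ℂ_[p]).comp (algebraMap ℤ_[p] ℚ_[p])) (PowerSeries.coeff i b) *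
      (χ (cyclotomicGenerator p : ZMod (p ^ m)) - 1) ^ i with hB
    -- `A · v z' = B · v z` from `a • z' = b • z`
    have hAB : A * v z' = B * v z := by rw [← hvlin a z', ← hvlin b z, hab]
    have h1 : (ρ * A) * v z = B * v z := by
      calc (ρ * A) * v z = A * (ρ * v z) := by ring
        _ = A * v z' := by rw [hprop]
        _ = B * v z := hAB
    exact mul_right_cancel₀ hvz h1
  obtain ⟨c₁, c₂, hc₁, hc₂, hc⟩ :=
    IwasawaAlgebra.exists_C_mul_eq_C_mul_of_values_proportional_finset ha P hP S hval
  -- `b ≠ 0` (domain), then constants: `C c₂ • z' = C c₁ • z`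
  have hb : b ≠ 0 := by
    intro hb0
    rw [hb0, mul_zero, mul_eq_zero] at hc
    rcases hc with h1 | h1
    · exact hc₁ (by simpa using (map_eq_zero_iff _ (PowerSeries.C_injective)).mp h1)
    · exact ha h1
  have hrel : PowerSeries.C c₂ • z' = PowerSeries.C c₁ • z := Module.smul_eq_smul_of_mul_eq_mul hab hb hc
  exact IwasawaAlgebra.lengthAt_quotient_span_singleton_eq_of_C_smul_eq_C_smul hc₂ hc₁ hrel 𝔮 hp𝔮

namespace IwasawaH1Data

variable {W : WeierstrassCurve ℚ} [W.IsElliptic] [ContinuousSMul ℤ_[p] (W.tateModule p)]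
  {κ : ZpExtension ℚ p} {γ : absoluteGaloisGroup ℚ} (I : IwasawaH1Data W p κ γ)

/-- **T22 (b) with FINITE-LEVEL hypotheses, finite-ratio form (the consumer shape).** Let `I : IwasawaH1Data W p κ γ` be a pin
with `γ` a topological generator of the cyclotomic `κ`, `z, z̃ ∈ 𝐇¹_Γ(T_pW)` with `z ≠ 0`, `P ⊂ ℂ_p` finite with `0 ∉ P`, and
suppose that for every primitive even character `χ` of `p`-power conductor with `χ(γ₀) − 1` outside a finite `S` some layer `n`
with `χ(γ₀)^{p^n} = 1` carries an additive, `ℤ_p`-semilinear `χ(γ₀)`-EIGENFUNCTIONAL `w` for `conj_γ` on `H¹(ℚ_n, T_pW)` with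
`w(proj_n z) ≠ 0` and `w(proj_n z̃) = ρ·w(proj_n z)` for some `ρ ∈ P` (Kato Thm. 12.5 (1) for the two newforms read through one
value datum; one period ratio seen through finitely many field embeddings). Then, granted `Kato2004.thm12_4`,
`ℓ_𝔮(𝐇¹/Λz̃) = ℓ_𝔮(𝐇¹/Λz)` at every prime `𝔮 ∌ p` of `Λ` (`apply_proj_smul_eq_tsum_mul` +
`lengthAt_quotient_span_eq_of_characterValues_proportional_finset`). Conditional on `h12`.
[cite: Kato2004Asterisque, Thm. 12.4 (2), Thm. 12.5 (1)(2) (pp. 221–222), 13.5 (2) (p. 227), §13.8 (p. 228)]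
[cite: MazurTateTeitelbaum1986Invent, §I.12–I.14] -/
theorem lengthAt_quotient_span_eq_of_layerFunctionals_finset (h12 : thm12_4) (hκ : κ.IsCyclotomic)
    (hγ : κ.IsTopGenerator γ) {z z' : I.H} (hz : z ≠ 0) (P : Finset ℂ_[p]) (hP : (0 : ℂ_[p]) ∉ P)
    (S : Finset ℂ_[p])
    (hw : ∀ m : ℕ, 0 < m → ∀ χ : DirichletCharacter ℂ_[p] (p ^ m), χ.IsPrimitive → χ.Even →
      (∃ j : ℕ, orderOf χ = p ^ j) → (χ (cyclotomicGenerator p : ZMod (p ^ m)) - 1) ∉ S →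
      ∃ (n : ℕ) (w : H1 (tateRep W p) (κ.layerSubgroup n) →+ ℂ_[p]),
        χ (cyclotomicGenerator p : ZMod (p ^ m)) ^ p ^ n = 1 ∧
        (∀ (c : ℤ_[p]) (y : H1 (tateRep W p) (κ.layerSubgroup n)),
          w (c • y) = ((algebraMap ℚ_[p] ℂ_[p]).comp (algebraMap ℤ_[p] ℚ_[p])) c * w y) ∧
        (∀ y : H1 (tateRep W p) (κ.layerSubgroup n),
          w ((conjMap (tateRep W p).toTopRep (κ.layerSubgroup n) γ 1).hom.toLinearMap y) =
            χ (cyclotomicGenerator p : ZMod (p ^ m)) * w y) ∧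
        w (I.proj n z) ≠ 0 ∧ ∃ ρ ∈ P, w (I.proj n z') = ρ * w (I.proj n z))
    (𝔮 : PrimeSpectrum (IwasawaAlgebra p)) (hp𝔮 : PowerSeries.C (p : ℤ_[p]) ∉ 𝔮.asIdeal) :
    Module.lengthAt (IwasawaAlgebra p) (I.H ⧸ Submodule.span (IwasawaAlgebra p) {z'}) 𝔮 =
      Module.lengthAt (IwasawaAlgebra p) (I.H ⧸ Submodule.span (IwasawaAlgebra p) {z}) 𝔮 := by
  obtain ⟨-, ⟨htf, hrk⟩, -⟩ := h12 W p κ γ hκ hγ I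
  haveI := htf
  refine lengthAt_quotient_span_eq_of_characterValues_proportional_finset hrk.le hz P hP S
    (fun m hm χ hχp hχe hχo htS ↦ ?_) 𝔮 hp𝔮
  obtain ⟨n, w, hζ, hw_smul, hw_conj, hwz, ρ, hρP, hprop⟩ := hw m hm χ hχp hχe hχo htS
  refine ⟨w.comp (I.proj n), fun a x ↦ ?_, ?_, ρ, hρP, ?_⟩
  · simp only [AddMonoidHom.coe_comp, Function.comp_apply]
    exact I.apply_proj_smul_eq_tsum_mul hγ n hζ w hw_smul hw_conj a x
  · simpa only [AddMonoidHom.coe_comp, Function.comp_apply] using hwz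
  · simpa only [AddMonoidHom.coe_comp, Function.comp_apply] using hprop

end IwasawaH1Data

end Kato2004

end Literature.NumberTheory.EllipticCurves

end
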